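/-
Copyright (c) 2026 the pub-hodgecm-mathlib formalisation cell (harness21).  Prover seat hodgecm-mathlib-F0P3a-p09 (g8): line LH3 (closer stub `stub_N9`), LETTER L3′, SURJ-OF-FORWARD road,
organ (Σ-WALL), W-ROAD brick (W3-T) «AMBIENT MULTIPLIERS KEEP `ArchSmooth₂`» + (N1′) «EXPLICIT AMBIENT-BUMP FORM OF ★ (N1)» (W-ROAD CENSUS v1 6129001bfae4ccc0, LH3-p01 (g6) 2026-09-02T13:04:17Z).
-/
import Literature.NumberTheory.Rogawski1990.ArchBouazizClassMultiplier        -- ★ p851490 (F0P3a-p04 (g25)) (Σ-MULT): `ArchSmooth₂.classMul` (the special case `M = F ∘ cl_amb`); brings ★ `ArchSmoothAmbientLift`, ★ (N1) `ArchEndoscopicProductTestFunction` (`exists_patternBump`, `coe_endoEmbArch_eq`, `snd_coe_fst_apply`, `snd_coe_snd_apply`, `contDiff_apply_snd_apply`), ★ `contDiff_exp_matrix_mixedSpace`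
import Literature.Geometry.ComplexHyperbolic.UnitBallFrameTransport        -- ★ `contDiff_matrix_of_entries` (entrywise transfer into the scoped-normed matrix type)
import HarnessLib

/-!
# Ambient smooth multipliers preserve `C_c^∞(H_∞)`; the explicit ambient-bump form of the product test functions (N1)
# (Borel–Jacquet 1979 §4.1; Borel 1972 3.4; Rogawski 1990 §14.3, §4.8; Bouaziz 1994 §5.1)

Topic `NumberTheory/Rogawski1990`; namespace `Literature.NumberTheory.Rogawski1990`.  THEOREMS ONLY (no `def`, no instance, no notation, no axiom, no named fact, no `sorry`).
Cell `pub/hodgecm-mathlib`, crux H413 (`stmt-HodgeConjecture-24833`), line LH3 (closer stub `stub_N9`), letter L3′, SURJ-OF-FORWARD road (RULINGS #22∕#23∕#25), organ (Σ-WALL)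
«rank-one inversion at a k-fold compact-wall base class» — the W-ROAD (FILTRATION ROAD, LH3-p01 (g6) census v1), brick **(W3-T)**: the generators `g_T` of (W3-asm) are products of a
positive tensor bump `Φ` (★ (N1)) by SMOOTH FUNCTIONS OF THE PLACE BLOCKS `(1 − (r_w ∘ cl_w)·κ_w)((e_A k.1) w)`; this file certifies that such products stay in `C_c^∞(H_∞)` (`ArchSmooth₂`).
Count-neutral.

THE MATHEMATICS.  `ArchSmooth₂ L fH` says `fH = φ ∘ ι_∞` for a continuous compactly supported right-translation-smooth `φ` on `GL₃(L ⊗ ℝ)`; by ★ `exists_contDiff_hasCompactSupport_of_isArchSmooth`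
`φ` is the restriction of an ambient `C^∞` function `Θ` on `M₃(L ⊗ ℝ)`.  For ANY `C^∞` function `M` on `M₃(L ⊗ ℝ)`, `(M ∘ val) · φ` is again such a witness (continuous, support inside that of
`φ`, and `X ↦ M(y·exp X)·Θ(y·exp X)` is `C^∞`, ★ `contDiff_exp_matrix_mixedSpace`), so **`k ↦ M(ι_∞ k) · fH k ∈ ArchSmooth₂`** (§1 `ArchSmooth₂.ambientMul` — ★ `ArchSmooth₂.classMul` is the
case `M = F ∘ cl_amb`).  §2 reads `M` through the PLACE BLOCKS: the complex coordinates of the pattern `ι_∞(a, b) = (a₀₀ 0 a₀₁; 0 b 0; a₁₀ 0 a₁₁)` (★ `coe_endoEmbArch_eq`) are the entries of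
`(e_A a)_w ∈ GL₂(ℂ)` and of `(e_1 b)_w` (★ `snd_coe_fst_apply`, ★ `snd_coe_snd_apply`), so for any `C^∞` function `N` of `(W → M₂(ℂ)) × (W → ℂ)`,
**`k ↦ N ((↑(e_A k.1 w))_w, ((e_1 k.2 w)₀₀)_w) · fH k ∈ ArchSmooth₂`** (`ArchSmooth₂.placeMul`).  §3 is (N1′): ★ (N1) `exists_archSmooth₂_prod`'s positive tensor bump WRITTEN OUT —
`k ↦ (∏_w β(Σ_{ij} ‖(e_A k.1 w)_{ij} − (a₀ w)_{ij}‖²)) · ∏_w β(‖(e_1 k.2 w)₀₀ − (e_1 b₀ w)₀₀‖²)` for ONE `β : ContDiffBump (0 : ℝ)` is `ArchSmooth₂` (★ `exists_patternBump` restricted along `ι_∞`; the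
off-pattern entries of `ι_∞ k − ι_∞(e_A⁻¹ a₀, b₀)` vanish, `β 0 = 1`), so the local factors are restrictions of the AMBIENT `C_c^∞(M₂(ℂ))` bumps `X ↦ β(Σ‖X_{ij} − a_{ij}‖²)` — smooth in the
block, as (W3-G)'s `F¹`, `F² := F¹·κ` require.
HONEST LABEL: test-function bookkeeping for the W-road; L3′ = «S-road organ-complete modulo (Σ-WALL)» until the W-bricks are ★; HC_CM is proved only modulo the 7 printed citations
(2 remaining: hLiu418 = `stmt-HodgeConjecture-24832`, h413 = `stmt-HodgeConjecture-24833`) until rung 0 closes; this file moves no row of the books.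

## References
* [BorelJacquet1979] A. Borel, H. Jacquet, *Automorphic forms and automorphic representations*, Proc. Sympos. Pure Math. 33.1 (1979), §1.1, §4.1.
* [Borel1972] A. Borel, *Représentations de groupes localement compacts*, LNM 276 (1972), 3.4.
* [Rogawski1990] J. D. Rogawski, *Automorphic Representations of Unitary Groups in Three Variables*, Ann. of Math. Stud. 123 (1990), §4.8 Case (a) p. 53; §14.3 p. 234.
* [Bouaziz1994IntegralesOrbitales] A. Bouaziz, *Intégrales orbitales sur les groupes de Lie réductifs*, Ann. Sci. ÉNS (4) 27 (1994), §5.1 p. 588 («`J_G(χφ) = χ J_G(φ)`»).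
-/

set_option autoImplicit false

noncomputable section

open MeasureTheory NumberField NumberField.InfinitePlace NumberField.mixedEmbedding Complex Set Function
open Literature.NumberTheory.Automorphic Literature.NumberTheory.Automorphic.UnitaryGroup Literature.NumberTheory.Automorphic.ArchCartan
open Literature.Geometry.ComplexHyperbolic.BallModel
open scoped Classical MatrixGroups Matrix ContDiff

namespace Literature.NumberTheory.Rogawski1990

variable (L : Type) [Field L] [NumberField L] [IsCMField L]

-- the scoped `ℓ^∞`-operator norm on `M₃(L ⊗ ℝ)` ∕ `M₂(ℂ)` (the one through which ★ `IsArchSmooth` is defined)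
open scoped Matrix.Norms.Operator

/-! ## §1 Ambient smooth multipliers preserve `ArchSmooth₂` -/

section Ambient

set_option backward.isDefEq.respectTransparency false in
/-- **(W3-T) AN AMBIENT SMOOTH MULTIPLIER PRESERVES `C_c^∞(H_∞)`**: for `fH ∈ ArchSmooth₂ L` and ANY `M : M₃(L ⊗ ℝ) → ℂ` of class `C^∞`, the product `k ↦ M (ι_∞ k) · fH k` is
`ArchSmooth₂ L` (`ι_∞ = endoEmbArch`, read as a matrix).  Witness on `GL₃(L ⊗ ℝ)`: `(M ∘ val) · φ` with `φ` the witness of `fH` and `Θ` its `C^∞` ambient lift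
(★ `exists_contDiff_hasCompactSupport_of_isArchSmooth`): continuous, support inside that of `φ`, smooth along `X ↦ y · exp X` (★ `contDiff_exp_matrix_mixedSpace`).  ★ `ArchSmooth₂.classMul`
is the case `M = F ∘ cl_amb`. [cite: BorelJacquet1979, §1.1, §4.1] [cite: Bouaziz1994IntegralesOrbitales, §5.1 p. 588] -/
theorem ArchSmooth₂.ambientMul
    {fH : ↥(arch (↥(maximalRealSubfield L)) L (IsCMField.complexConj L) 2 (Matrix.of fun i j : Fin 2 => if i.val + j.val + 1 = 2 then (1 : L) else 0)) ×
        ↥(arch (↥(maximalRealSubfield L)) L (IsCMField.complexConj L) 1 (Matrix.of fun i j : Fin 1 => if i.val + j.val + 1 = 1 then (1 : L) else 0)) → ℂ}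
    (hfH : ArchSmooth₂ L fH) {M : Matrix (Fin 3) (Fin 3) (mixedSpace L) → ℂ} (hM : ContDiff ℝ ∞ M) :
    ArchSmooth₂ L (fun k => M ((endoEmbArch L k).val : Matrix (Fin 3) (Fin 3) (mixedSpace L)) * fH k) := by
  obtain ⟨φ, hφc, hφs, hφsm, hφa⟩ := hfH
  obtain ⟨Θ, hΘ, -, -, hΘφ⟩ := exists_contDiff_hasCompactSupport_of_isArchSmooth φ hφs hφsm
  refine ⟨fun g => M (g : Matrix (Fin 3) (Fin 3) (mixedSpace L)) * φ g, ?_, hφs.mul_left, fun y => ?_, fun k => ?_⟩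
  rotate_right
  · show M ((endoEmbArch L k).val : Matrix (Fin 3) (Fin 3) (mixedSpace L)) * fH k =
      M ((endoEmbArch L k).val : Matrix (Fin 3) (Fin 3) (mixedSpace L)) * φ ((endoEmbArch L k).val : GL (Fin 3) (mixedSpace L))
    rw [hφa]
  · exact (hM.continuous.comp Units.continuous_val).mul hφc
  · -- Mathlib idiom (Mathlib/Algebra/Lie/OfAssociative.lean): the Lie structure on `M₃(L ⊗ ℝ)` through which ★ `archGroupGL` speaks
    letI : LieRing (Matrix (Fin 3) (Fin 3) (mixedSpace L)) := LieRing.ofAssociativeRing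
    letI : LieAlgebra ℝ (Matrix (Fin 3) (Fin 3) (mixedSpace L)) := LieAlgebra.ofAssociativeAlgebra
    show ContDiff ℝ ∞ fun X : (archGroupGL 3 L).lie.toSubmodule =>
      M (((y : GL (Fin 3) (mixedSpace L)) * expGL (X : Matrix (Fin 3) (Fin 3) (mixedSpace L)) : GL (Fin 3) (mixedSpace L)) : Matrix (Fin 3) (Fin 3) (mixedSpace L)) *
        φ ((y : GL (Fin 3) (mixedSpace L)) * expGL (X : Matrix (Fin 3) (Fin 3) (mixedSpace L)))
    have hval : ContDiff ℝ ∞ fun X : (archGroupGL 3 L).lie.toSubmodule => (X : Matrix (Fin 3) (Fin 3) (mixedSpace L)) := (archGroupGL 3 L).lie.toSubmodule.subtypeL.contDiff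
    have h : (fun X : (archGroupGL 3 L).lie.toSubmodule =>
        M (((y : GL (Fin 3) (mixedSpace L)) * expGL (X : Matrix (Fin 3) (Fin 3) (mixedSpace L)) : GL (Fin 3) (mixedSpace L)) : Matrix (Fin 3) (Fin 3) (mixedSpace L)) *
          φ ((y : GL (Fin 3) (mixedSpace L)) * expGL (X : Matrix (Fin 3) (Fin 3) (mixedSpace L)))) =
        fun X : (archGroupGL 3 L).lie.toSubmodule =>
          M (((y : GL (Fin 3) (mixedSpace L)) : Matrix (Fin 3) (Fin 3) (mixedSpace L)) * NormedSpace.exp (X : Matrix (Fin 3) (Fin 3) (mixedSpace L))) *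
            Θ (((y : GL (Fin 3) (mixedSpace L)) : Matrix (Fin 3) (Fin 3) (mixedSpace L)) * NormedSpace.exp (X : Matrix (Fin 3) (Fin 3) (mixedSpace L))) := by
      funext X; rw [hΘφ, Units.val_mul, coe_expGL]
    rw [h]
    have hexp : ContDiff ℝ ∞ fun X : (archGroupGL 3 L).lie.toSubmodule =>
        ((y : GL (Fin 3) (mixedSpace L)) : Matrix (Fin 3) (Fin 3) (mixedSpace L)) * NormedSpace.exp (X : Matrix (Fin 3) (Fin 3) (mixedSpace L)) :=
      contDiff_const.mul (contDiff_exp_matrix_mixedSpace.comp hval)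
    exact (hM.comp hexp).mul (hΘ.comp hexp)

end Ambient

/-! ## §2 Multipliers read through the place blocks `(e_A k.1) w ∈ GL₂(ℂ)` and `(e_1 k.2) w` -/

section Place

omit [IsCMField L] in
set_option backward.isDefEq.respectTransparency false in
/-- The block reader `X ↦ ((X₀₀ X₀₂; X₂₀ X₂₂)_w, (X₁₁)_w)_w` of the pattern coordinates is `C^∞` on `M₃(L ⊗ ℝ)` (★ `contDiff_apply_snd_apply` entry by entry).
[cite: BorelJacquet1979, §4.1] -/
theorem contDiff_patternBlocks :
    ContDiff ℝ ∞ fun X : Matrix (Fin 3) (Fin 3) (mixedSpace L) =>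
      ((fun w : {w : InfinitePlace L // IsComplex w} => !![(X 0 0).2 w, (X 0 2).2 w; (X 2 0).2 w, (X 2 2).2 w]),
        (fun w : {w : InfinitePlace L // IsComplex w} => (X 1 1).2 w)) := by
  refine (contDiff_pi.2 fun w => contDiff_matrix_of_entries fun i j => ?_).prodMk (contDiff_pi.2 fun w => contDiff_apply_snd_apply L 1 1 w)
  fin_cases i <;> fin_cases j
  · exact contDiff_apply_snd_apply L 0 0 w
  · exact contDiff_apply_snd_apply L 0 2 w
  · exact contDiff_apply_snd_apply L 2 0 w
  · exact contDiff_apply_snd_apply L 2 2 w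

/-- **On `ι_∞(H_∞)` the block reader IS `(e_A k.1, (e_1 k.2)₀₀)`** (★ `coe_endoEmbArch_eq`, ★ `snd_coe_fst_apply`, ★ `snd_coe_snd_apply`). [cite: Rogawski1990, §4.8 Case (a) p. 53] -/
theorem patternBlocks_endoEmbArch
    (k : ↥(arch (↥(maximalRealSubfield L)) L (IsCMField.complexConj L) 2 (Matrix.of fun i j : Fin 2 => if i.val + j.val + 1 = 2 then (1 : L) else 0)) ×
        ↥(arch (↥(maximalRealSubfield L)) L (IsCMField.complexConj L) 1 (Matrix.of fun i j : Fin 1 => if i.val + j.val + 1 = 1 then (1 : L) else 0))) :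
    ((fun w : {w : InfinitePlace L // IsComplex w} =>
        !![(((endoEmbArch L k).val : Matrix (Fin 3) (Fin 3) (mixedSpace L)) 0 0).2 w, (((endoEmbArch L k).val : Matrix (Fin 3) (Fin 3) (mixedSpace L)) 0 2).2 w;
          (((endoEmbArch L k).val : Matrix (Fin 3) (Fin 3) (mixedSpace L)) 2 0).2 w, (((endoEmbArch L k).val : Matrix (Fin 3) (Fin 3) (mixedSpace L)) 2 2).2 w]),
      (fun w : {w : InfinitePlace L // IsComplex w} => (((endoEmbArch L k).val : Matrix (Fin 3) (Fin 3) (mixedSpace L)) 1 1).2 w)) =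
      ((fun w => ((archPiEquivCM 2 L (Matrix.of fun i j : Fin 2 => if i.val + j.val + 1 = 2 then (1 : L) else 0) k.1 w : GL (Fin 2) ℂ) : Matrix (Fin 2) (Fin 2) ℂ)),
        (fun w => ((archPiEquivCM 1 L (Matrix.of fun i j : Fin 1 => if i.val + j.val + 1 = 1 then (1 : L) else 0) k.2 w : GL (Fin 1) ℂ) : Matrix (Fin 1) (Fin 1) ℂ) 0 0)) := by
  refine Prod.ext (funext fun w => ?_) (funext fun w => ?_)
  · rw [coe_endoEmbArch_eq]
    simp only [Matrix.of_apply, Matrix.cons_val', Matrix.cons_val_zero, Matrix.cons_val_two, Matrix.empty_val', Matrix.cons_val_fin_one,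
      Matrix.head_cons, Matrix.tail_cons, Matrix.head_fin_const]
    rw [snd_coe_fst_apply L k w 0 0, snd_coe_fst_apply L k w 0 1, snd_coe_fst_apply L k w 1 0, snd_coe_fst_apply L k w 1 1]
    exact (Matrix.eta_fin_two _).symm
  · rw [coe_endoEmbArch_eq]
    simp only [Matrix.of_apply, Matrix.cons_val', Matrix.cons_val_zero, Matrix.cons_val_one, Matrix.empty_val', Matrix.cons_val_fin_one]
    rw [snd_coe_snd_apply L k w]

/-- **(W3-T) MULTIPLIERS OF THE PLACE BLOCKS PRESERVE `C_c^∞(H_∞)`**: for `fH ∈ ArchSmooth₂ L` and ANY `C^∞` function `N` of `(W → M₂(ℂ)) × (W → ℂ)`,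
`k ↦ N ((↑(e_A k.1 w))_w, ((e_1 k.2 w)₀₀)_w) · fH k` is `ArchSmooth₂ L` (§1 with `M := N ∘` block reader).  The generators of (W3-asm),
`g_T = (∏_{w ∈ Z∖T} (1 − (r_w ∘ cl_w)·κ_w)((e_A k.1) w)) · Φ`, are of this shape. [cite: BorelJacquet1979, §4.1] [cite: Bouaziz1994IntegralesOrbitales, §5.1 p. 588] -/
theorem ArchSmooth₂.placeMul
    {fH : ↥(arch (↥(maximalRealSubfield L)) L (IsCMField.complexConj L) 2 (Matrix.of fun i j : Fin 2 => if i.val + j.val + 1 = 2 then (1 : L) else 0)) ×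
        ↥(arch (↥(maximalRealSubfield L)) L (IsCMField.complexConj L) 1 (Matrix.of fun i j : Fin 1 => if i.val + j.val + 1 = 1 then (1 : L) else 0)) → ℂ}
    (hfH : ArchSmooth₂ L fH)
    {N : ({w : InfinitePlace L // IsComplex w} → Matrix (Fin 2) (Fin 2) ℂ) × ({w : InfinitePlace L // IsComplex w} → ℂ) → ℂ} (hN : ContDiff ℝ ∞ N) :
    ArchSmooth₂ L (fun k => N
      ((fun w => ((archPiEquivCM 2 L (Matrix.of fun i j : Fin 2 => if i.val + j.val + 1 = 2 then (1 : L) else 0) k.1 w : GL (Fin 2) ℂ) : Matrix (Fin 2) (Fin 2) ℂ)),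
        (fun w => ((archPiEquivCM 1 L (Matrix.of fun i j : Fin 1 => if i.val + j.val + 1 = 1 then (1 : L) else 0) k.2 w : GL (Fin 1) ℂ) : Matrix (Fin 1) (Fin 1) ℂ) 0 0)) * fH k) := by
  have h := ArchSmooth₂.ambientMul L hfH (hN.comp (contDiff_patternBlocks L))
  simp only [Function.comp_apply, patternBlocks_endoEmbArch] at h
  exact h

/-- The `U(Φ₂)`-blocks alone: for `N : (W → M₂(ℂ)) → ℂ` of class `C^∞`, `k ↦ N ((↑(e_A k.1 w))_w) · fH k ∈ ArchSmooth₂ L`. [cite: BorelJacquet1979, §4.1] -/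
theorem ArchSmooth₂.placeMul_fst
    {fH : ↥(arch (↥(maximalRealSubfield L)) L (IsCMField.complexConj L) 2 (Matrix.of fun i j : Fin 2 => if i.val + j.val + 1 = 2 then (1 : L) else 0)) ×
        ↥(arch (↥(maximalRealSubfield L)) L (IsCMField.complexConj L) 1 (Matrix.of fun i j : Fin 1 => if i.val + j.val + 1 = 1 then (1 : L) else 0)) → ℂ}
    (hfH : ArchSmooth₂ L fH) {N : ({w : InfinitePlace L // IsComplex w} → Matrix (Fin 2) (Fin 2) ℂ) → ℂ} (hN : ContDiff ℝ ∞ N) :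
    ArchSmooth₂ L (fun k => N (fun w => ((archPiEquivCM 2 L (Matrix.of fun i j : Fin 2 => if i.val + j.val + 1 = 2 then (1 : L) else 0) k.1 w : GL (Fin 2) ℂ) : Matrix (Fin 2) (Fin 2) ℂ)) * fH k) :=
  ArchSmooth₂.placeMul L hfH (N := fun p => N p.1) (hN.comp contDiff_fst)

end Place

/-! ## §3 (N1′) The product test functions of ★ (N1), written out as restrictions of ambient bumps -/

section Explicit

set_option backward.isDefEq.respectTransparency false in
/-- **(N1′) THE EXPLICIT POSITIVE TENSOR BUMP**: for any centre `a₀ : ∀ w, U(Φ₂)_w`, `b₀ ∈ U(Φ₁)_∞` there is ONE bump `β : ContDiffBump (0 : ℝ)` (`β ≥ 0`, `β = 1` near `0`) such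
that `k ↦ (∏_w β(Σ_{i,j} ‖(e_A k.1 w)_{ij} − (a₀ w)_{ij}‖²)) · ∏_w β(‖(e_1 k.2 w)₀₀ − (e_1 b₀ w)₀₀‖²)` is an `ArchSmooth₂` test function on `H_∞` — the restriction along `ι_∞` of the
pattern bump ★ `exists_patternBump` centred at `ι_∞(e_A⁻¹ a₀, b₀)` (the off-pattern coordinates of `ι_∞ k − ι_∞(e_A⁻¹ a₀, b₀)` vanish, `β 0 = 1`).  So the local factors of ★ (N1)
`exists_archSmooth₂_prod` ARE the restrictions of the AMBIENT `C_c^∞(M₂(ℂ))` bumps `X ↦ β(Σ‖X_{ij} − (a₀ w)_{ij}‖²)`.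
[cite: Rogawski1990, §14.3 p. 234; §4.8 Case (a) p. 53] [cite: BorelJacquet1979, §4.1] [cite: Borel1972, 3.4] -/
theorem exists_contDiffBump_archSmooth₂_prod
    (a₀ : ∀ w : {w : InfinitePlace L // IsComplex w}, ↥(archLocal L 2 (Matrix.of fun i j : Fin 2 => if i.val + j.val + 1 = 2 then (1 : L) else 0) w))
    (b₀ : ↥(arch (↥(maximalRealSubfield L)) L (IsCMField.complexConj L) 1 (Matrix.of fun i j : Fin 1 => if i.val + j.val + 1 = 1 then (1 : L) else 0))) :
    ∃ β : ContDiffBump (0 : ℝ),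
      ArchSmooth₂ L (fun k : (↥(arch (↥(maximalRealSubfield L)) L (IsCMField.complexConj L) 2 (Matrix.of fun i j : Fin 2 => if i.val + j.val + 1 = 2 then (1 : L) else 0)) ×
          ↥(arch (↥(maximalRealSubfield L)) L (IsCMField.complexConj L) 1 (Matrix.of fun i j : Fin 1 => if i.val + j.val + 1 = 1 then (1 : L) else 0))) =>
        (∏ w : {w : InfinitePlace L // IsComplex w},
            ((β (‖((archPiEquivCM 2 L (Matrix.of fun i j : Fin 2 => if i.val + j.val + 1 = 2 then (1 : L) else 0) k.1 w : GL (Fin 2) ℂ) : Matrix (Fin 2) (Fin 2) ℂ) 0 0 - ((a₀ w : GL (Fin 2) ℂ) : Matrix (Fin 2) (Fin 2) ℂ) 0 0‖ ^ 2 +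
                  ‖((archPiEquivCM 2 L (Matrix.of fun i j : Fin 2 => if i.val + j.val + 1 = 2 then (1 : L) else 0) k.1 w : GL (Fin 2) ℂ) : Matrix (Fin 2) (Fin 2) ℂ) 0 1 - ((a₀ w : GL (Fin 2) ℂ) : Matrix (Fin 2) (Fin 2) ℂ) 0 1‖ ^ 2 +
                  ‖((archPiEquivCM 2 L (Matrix.of fun i j : Fin 2 => if i.val + j.val + 1 = 2 then (1 : L) else 0) k.1 w : GL (Fin 2) ℂ) : Matrix (Fin 2) (Fin 2) ℂ) 1 0 - ((a₀ w : GL (Fin 2) ℂ) : Matrix (Fin 2) (Fin 2) ℂ) 1 0‖ ^ 2 +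
                  ‖((archPiEquivCM 2 L (Matrix.of fun i j : Fin 2 => if i.val + j.val + 1 = 2 then (1 : L) else 0) k.1 w : GL (Fin 2) ℂ) : Matrix (Fin 2) (Fin 2) ℂ) 1 1 - ((a₀ w : GL (Fin 2) ℂ) : Matrix (Fin 2) (Fin 2) ℂ) 1 1‖ ^ 2) : ℝ) : ℂ)) *
          ((∏ w : {w : InfinitePlace L // IsComplex w},
              β (‖((archPiEquivCM 1 L (Matrix.of fun i j : Fin 1 => if i.val + j.val + 1 = 1 then (1 : L) else 0) k.2 w : GL (Fin 1) ℂ) : Matrix (Fin 1) (Fin 1) ℂ) 0 0 -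
                    ((archPiEquivCM 1 L (Matrix.of fun i j : Fin 1 => if i.val + j.val + 1 = 1 then (1 : L) else 0) b₀ w : GL (Fin 1) ℂ) : Matrix (Fin 1) (Fin 1) ℂ) 0 0‖ ^ 2) : ℝ) : ℂ)) := by
  -- the centre `x₀ = ι_∞(A₀, b₀)`, `e_A A₀ = a₀`
  obtain ⟨A₀, hA₀⟩ : ∃ A₀ : ↥(arch (↥(maximalRealSubfield L)) L (IsCMField.complexConj L) 2 (Matrix.of fun i j : Fin 2 => if i.val + j.val + 1 = 2 then (1 : L) else 0)),
      archPiEquivCM 2 L (Matrix.of fun i j : Fin 2 => if i.val + j.val + 1 = 2 then (1 : L) else 0) A₀ = a₀ :=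
    ⟨_, (archPiEquivCM 2 L (Matrix.of fun i j : Fin 2 => if i.val + j.val + 1 = 2 then (1 : L) else 0)).apply_symm_apply a₀⟩
  obtain ⟨x₀, hx₀⟩ : ∃ x₀ : Matrix (Fin 3) (Fin 3) (mixedSpace L), x₀ = ((endoEmbArch L (A₀, b₀)).val : Matrix (Fin 3) (Fin 3) (mixedSpace L)) := ⟨_, rfl⟩
  have hx₀u : IsUnit x₀ := by rw [hx₀]; exact Units.isUnit _
  obtain ⟨β, φ, hφc, hφs, hφsm, hφ⟩ := exists_patternBump L x₀ hx₀u
  have hβ0 : β 0 = 1 := β.one_of_mem_closedBall (Metric.mem_closedBall_self β.rIn_pos.le)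
  -- the local factors, kept OPAQUE during the computation (as in ★ (N1)'s proof)
  obtain ⟨f, hf⟩ : ∃ f : ∀ w : {w : InfinitePlace L // IsComplex w}, ↥(archLocal L 2 (Matrix.of fun i j : Fin 2 => if i.val + j.val + 1 = 2 then (1 : L) else 0) w) → ℝ, ∀ w x, f w x =
      β (‖((x : GL (Fin 2) ℂ) : Matrix (Fin 2) (Fin 2) ℂ) 0 0 - ((a₀ w : GL (Fin 2) ℂ) : Matrix (Fin 2) (Fin 2) ℂ) 0 0‖ ^ 2 +
         ‖((x : GL (Fin 2) ℂ) : Matrix (Fin 2) (Fin 2) ℂ) 0 1 - ((a₀ w : GL (Fin 2) ℂ) : Matrix (Fin 2) (Fin 2) ℂ) 0 1‖ ^ 2 +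
         ‖((x : GL (Fin 2) ℂ) : Matrix (Fin 2) (Fin 2) ℂ) 1 0 - ((a₀ w : GL (Fin 2) ℂ) : Matrix (Fin 2) (Fin 2) ℂ) 1 0‖ ^ 2 +
         ‖((x : GL (Fin 2) ℂ) : Matrix (Fin 2) (Fin 2) ℂ) 1 1 - ((a₀ w : GL (Fin 2) ℂ) : Matrix (Fin 2) (Fin 2) ℂ) 1 1‖ ^ 2) := ⟨_, fun _ _ => rfl⟩
  obtain ⟨g, hg⟩ : ∃ g : ↥(arch (↥(maximalRealSubfield L)) L (IsCMField.complexConj L) 1 (Matrix.of fun i j : Fin 1 => if i.val + j.val + 1 = 1 then (1 : L) else 0)) → ℝ, ∀ b, g b = ∏ w : {w : InfinitePlace L // IsComplex w},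
      β (‖((archPiEquivCM 1 L (Matrix.of fun i j : Fin 1 => if i.val + j.val + 1 = 1 then (1 : L) else 0) b w : GL (Fin 1) ℂ) : Matrix (Fin 1) (Fin 1) ℂ) 0 0 -
          ((archPiEquivCM 1 L (Matrix.of fun i j : Fin 1 => if i.val + j.val + 1 = 1 then (1 : L) else 0) b₀ w : GL (Fin 1) ℂ) : Matrix (Fin 1) (Fin 1) ℂ) 0 0‖ ^ 2) := ⟨_, fun _ => rfl⟩
  -- THE FACTORISATION on `ι_∞(H_∞)` (verbatim from ★ (N1)'s proof)
  have hx₀pat : ∀ w, (x₀ 0 0).2 w = ((a₀ w : GL (Fin 2) ℂ) : Matrix (Fin 2) (Fin 2) ℂ) 0 0 ∧ (x₀ 0 2).2 w = ((a₀ w : GL (Fin 2) ℂ) : Matrix (Fin 2) (Fin 2) ℂ) 0 1 ∧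
      (x₀ 2 0).2 w = ((a₀ w : GL (Fin 2) ℂ) : Matrix (Fin 2) (Fin 2) ℂ) 1 0 ∧ (x₀ 2 2).2 w = ((a₀ w : GL (Fin 2) ℂ) : Matrix (Fin 2) (Fin 2) ℂ) 1 1 ∧
      (x₀ 1 1).2 w = ((archPiEquivCM 1 L (Matrix.of fun i j : Fin 1 => if i.val + j.val + 1 = 1 then (1 : L) else 0) b₀ w : GL (Fin 1) ℂ) : Matrix (Fin 1) (Fin 1) ℂ) 0 0 ∧
      (x₀ 0 1).2 w = 0 ∧ (x₀ 1 0).2 w = 0 ∧ (x₀ 1 2).2 w = 0 ∧ (x₀ 2 1).2 w = 0 := fun w => by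
    rw [← hA₀, hx₀, coe_endoEmbArch_eq]
    exact ⟨rfl, rfl, rfl, rfl, rfl, rfl, rfl, rfl, rfl⟩
  have hfac : ∀ k : (↥(arch (↥(maximalRealSubfield L)) L (IsCMField.complexConj L) 2 (Matrix.of fun i j : Fin 2 => if i.val + j.val + 1 = 2 then (1 : L) else 0)) ×
        ↥(arch (↥(maximalRealSubfield L)) L (IsCMField.complexConj L) 1 (Matrix.of fun i j : Fin 1 => if i.val + j.val + 1 = 1 then (1 : L) else 0))),
      φ ((endoEmbArch L k).val : GL (Fin 3) (mixedSpace L)) =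
        (∏ w, ((f w (archPiEquivCM 2 L (Matrix.of fun i j : Fin 2 => if i.val + j.val + 1 = 2 then (1 : L) else 0) k.1 w) : ℝ) : ℂ)) * ((g k.2 : ℝ) : ℂ) := fun k => by
    obtain ⟨y, hy⟩ : ∃ y : Matrix (Fin 3) (Fin 3) (mixedSpace L), y = ((endoEmbArch L k).val : Matrix (Fin 3) (Fin 3) (mixedSpace L)) := ⟨_, rfl⟩
    have hypat : (y 0 0) = ((k.1.val : GL (Fin 2) (mixedSpace L)) : Matrix (Fin 2) (Fin 2) (mixedSpace L)) 0 0 ∧ (y 0 2) = ((k.1.val : GL (Fin 2) (mixedSpace L)) : Matrix (Fin 2) (Fin 2) (mixedSpace L)) 0 1 ∧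
        (y 2 0) = ((k.1.val : GL (Fin 2) (mixedSpace L)) : Matrix (Fin 2) (Fin 2) (mixedSpace L)) 1 0 ∧ (y 2 2) = ((k.1.val : GL (Fin 2) (mixedSpace L)) : Matrix (Fin 2) (Fin 2) (mixedSpace L)) 1 1 ∧
        (y 1 1) = ((k.2.val : GL (Fin 1) (mixedSpace L)) : Matrix (Fin 1) (Fin 1) (mixedSpace L)) 0 0 ∧
        y 0 1 = 0 ∧ y 1 0 = 0 ∧ y 1 2 = 0 ∧ y 2 1 = 0 := by
      rw [hy, coe_endoEmbArch_eq]
      exact ⟨rfl, rfl, rfl, rfl, rfl, rfl, rfl, rfl, rfl⟩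
    obtain ⟨hy00, hy02, hy20, hy22, hy11, hy01, hy10, hy12, hy21⟩ := hypat
    have hoff0 : ∀ w, ‖(y 0 1).2 w - (x₀ 0 1).2 w‖ ^ 2 + ‖(y 1 0).2 w - (x₀ 1 0).2 w‖ ^ 2 + ‖(y 1 2).2 w - (x₀ 1 2).2 w‖ ^ 2 + ‖(y 2 1).2 w - (x₀ 2 1).2 w‖ ^ 2 = 0 := fun w => by
      obtain ⟨-, -, -, -, -, h01, h10, h12, h21⟩ := hx₀pat w
      rw [hy01, hy10, hy12, hy21, h01, h10, h12, h21]
      simp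
    have hQf : ∀ w, β (‖(y 0 0).2 w - (x₀ 0 0).2 w‖ ^ 2 + ‖(y 0 2).2 w - (x₀ 0 2).2 w‖ ^ 2 + ‖(y 2 0).2 w - (x₀ 2 0).2 w‖ ^ 2 + ‖(y 2 2).2 w - (x₀ 2 2).2 w‖ ^ 2) =
        f w (archPiEquivCM 2 L (Matrix.of fun i j : Fin 2 => if i.val + j.val + 1 = 2 then (1 : L) else 0) k.1 w) := fun w => by
      obtain ⟨h00, h02, h20, h22, -, -, -, -, -⟩ := hx₀pat w
      rw [hf, hy00, hy02, hy20, hy22, h00, h02, h20, h22, snd_coe_fst_apply L k w 0 0, snd_coe_fst_apply L k w 0 1, snd_coe_fst_apply L k w 1 0,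
        snd_coe_fst_apply L k w 1 1]
    have hPg : ∀ w, β (‖(y 1 1).2 w - (x₀ 1 1).2 w‖ ^ 2) =
        β (‖((archPiEquivCM 1 L (Matrix.of fun i j : Fin 1 => if i.val + j.val + 1 = 1 then (1 : L) else 0) k.2 w : GL (Fin 1) ℂ) : Matrix (Fin 1) (Fin 1) ℂ) 0 0 -
          ((archPiEquivCM 1 L (Matrix.of fun i j : Fin 1 => if i.val + j.val + 1 = 1 then (1 : L) else 0) b₀ w : GL (Fin 1) ℂ) : Matrix (Fin 1) (Fin 1) ℂ) 0 0‖ ^ 2) := fun w => by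
      obtain ⟨-, -, -, -, h11, -, -, -, -⟩ := hx₀pat w
      rw [hy11, h11, snd_coe_snd_apply L k w]
    rw [hφ, ← hy, Finset.sum_eq_zero fun w _ => hoff0 w, hβ0, one_mul, Finset.prod_mul_distrib, Complex.ofReal_mul, Complex.ofReal_prod, hg]
    congr 1
    · exact Finset.prod_congr rfl fun w _ => by rw [hQf w]
    · rw [Finset.prod_congr rfl fun w _ => hPg w]
  -- the `ArchSmooth₂` witness, with the local factors unfolded in the statement
  refine ⟨β, φ, hφc, hφs, hφsm, fun k => ?_⟩
  rw [hfac k]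
  simp only [hf, hg, Complex.ofReal_prod]

/-- The ambient local bump `X ↦ β(Σ_{i,j} ‖X_{ij} − a_{ij}‖²)` on `M₂(ℂ)` is `C^∞` (for (W3-G)'s `F¹`, `F² := F¹ · κ`). [cite: BorelJacquet1979, §4.1] [cite: Borel1972, 3.4] -/
theorem contDiff_contDiffBump_sum_norm_sq_sub (β : ContDiffBump (0 : ℝ)) (a : Matrix (Fin 2) (Fin 2) ℂ) :
    ContDiff ℝ ∞ fun X : Matrix (Fin 2) (Fin 2) ℂ =>
      β (‖X 0 0 - a 0 0‖ ^ 2 + ‖X 0 1 - a 0 1‖ ^ 2 + ‖X 1 0 - a 1 0‖ ^ 2 + ‖X 1 1 - a 1 1‖ ^ 2) := by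
  have hent : ∀ i j : Fin 2, ContDiff ℝ ∞ fun X : Matrix (Fin 2) (Fin 2) ℂ => X i j := fun i j =>
    (LinearMap.toContinuousLinearMap (Matrix.entryLinearMap ℝ ℂ i j)).contDiff
  have he : ∀ i j : Fin 2, ContDiff ℝ ∞ fun X : Matrix (Fin 2) (Fin 2) ℂ => ‖X i j - a i j‖ ^ 2 := fun i j =>
    (contDiff_norm_sq ℝ (n := ∞)).comp ((hent i j).sub contDiff_const)
  exact β.contDiff.comp ((((he 0 0).add (he 0 1)).add (he 1 0)).add (he 1 1))

/-- The ambient local bump is non-negative and equals `1` at its centre. [cite: Borel1972, 3.4] -/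
theorem contDiffBump_sum_norm_sq_sub_nonneg_and_apply_self (β : ContDiffBump (0 : ℝ)) (a : Matrix (Fin 2) (Fin 2) ℂ) :
    (∀ X : Matrix (Fin 2) (Fin 2) ℂ, 0 ≤ β (‖X 0 0 - a 0 0‖ ^ 2 + ‖X 0 1 - a 0 1‖ ^ 2 + ‖X 1 0 - a 1 0‖ ^ 2 + ‖X 1 1 - a 1 1‖ ^ 2)) ∧
      β (‖a 0 0 - a 0 0‖ ^ 2 + ‖a 0 1 - a 0 1‖ ^ 2 + ‖a 1 0 - a 1 0‖ ^ 2 + ‖a 1 1 - a 1 1‖ ^ 2) = 1 := by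
  refine ⟨fun X => β.nonneg, ?_⟩
  simp only [sub_self, norm_zero]
  norm_num
  exact β.one_of_mem_closedBall (Metric.mem_closedBall_self β.rIn_pos.le)

end Explicit

/-! ## §4 Every smooth function of the place blocks supported near a centre IS a test function -/

section BlockSupport

/-- **(W3-T′) BLOCK-SUPPORTED SMOOTH FUNCTIONS OF THE PLACE BLOCKS ARE `ArchSmooth₂`** — the shape the W-road generators eat: for every centre `a₀ : ∀ w, U(Φ₂)_w`, `b₀ ∈ U(Φ₁)_∞`
there is `ε > 0` such that EVERY `C^∞` function `N` of `(W → M₂(ℂ)) × (W → ℂ)` which vanishes unless all its arguments are `ε`-close to the centre blocks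
(`Σ_{ij} ‖A_w ij − (a₀ w)_ij‖² ≤ ε` and `‖u_w − (e_1 b₀ w)₀₀‖² ≤ ε` at every `w`) gives an `ArchSmooth₂` function `k ↦ N ((↑(e_A k.1 w))_w, ((e_1 k.2 w)₀₀)_w)`.  In particular the PURE
TENSORS `k ↦ ∏_w f_w(e_A k.1 w) · ∏_w g_w((e_1 k.2 w)₀₀)` of restrictions of ambient `C_c^∞(M₂(ℂ))` ∕ `C_c^∞(ℂ)` functions supported in those blockwise balls (LH3-p02 (g5)'s (W3-G)
generators `f₀ ∘ coe`, `tsupport f₀ ⊆ U`).  Proof: §2 `placeMul` with `Φ` = the (N1′) β-tensor bump at `(a₀, b₀)` and `ε := β.rIn`: wherever `N ≠ 0` every bump factor equals `1`.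
[cite: Borel1972, 3.4] [cite: BorelJacquet1979, §4.1] [cite: Bouaziz1994IntegralesOrbitales, §5.1 p. 588] -/
theorem exists_pos_archSmooth₂_of_blockSupport
    (a₀ : ∀ w : {w : InfinitePlace L // IsComplex w}, ↥(archLocal L 2 (Matrix.of fun i j : Fin 2 => if i.val + j.val + 1 = 2 then (1 : L) else 0) w))
    (b₀ : ↥(arch (↥(maximalRealSubfield L)) L (IsCMField.complexConj L) 1 (Matrix.of fun i j : Fin 1 => if i.val + j.val + 1 = 1 then (1 : L) else 0))) :
    ∃ ε : ℝ, 0 < ε ∧ ∀ N : ({w : InfinitePlace L // IsComplex w} → Matrix (Fin 2) (Fin 2) ℂ) × ({w : InfinitePlace L // IsComplex w} → ℂ) → ℂ, ContDiff ℝ ∞ N →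
      (∀ p, N p ≠ 0 →
        (∀ w, ‖p.1 w 0 0 - ((a₀ w : GL (Fin 2) ℂ) : Matrix (Fin 2) (Fin 2) ℂ) 0 0‖ ^ 2 + ‖p.1 w 0 1 - ((a₀ w : GL (Fin 2) ℂ) : Matrix (Fin 2) (Fin 2) ℂ) 0 1‖ ^ 2 +
              ‖p.1 w 1 0 - ((a₀ w : GL (Fin 2) ℂ) : Matrix (Fin 2) (Fin 2) ℂ) 1 0‖ ^ 2 + ‖p.1 w 1 1 - ((a₀ w : GL (Fin 2) ℂ) : Matrix (Fin 2) (Fin 2) ℂ) 1 1‖ ^ 2 ≤ ε) ∧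
        (∀ w, ‖p.2 w - ((archPiEquivCM 1 L (Matrix.of fun i j : Fin 1 => if i.val + j.val + 1 = 1 then (1 : L) else 0) b₀ w : GL (Fin 1) ℂ) : Matrix (Fin 1) (Fin 1) ℂ) 0 0‖ ^ 2 ≤ ε)) →
      ArchSmooth₂ L (fun k : (↥(arch (↥(maximalRealSubfield L)) L (IsCMField.complexConj L) 2 (Matrix.of fun i j : Fin 2 => if i.val + j.val + 1 = 2 then (1 : L) else 0)) ×
          ↥(arch (↥(maximalRealSubfield L)) L (IsCMField.complexConj L) 1 (Matrix.of fun i j : Fin 1 => if i.val + j.val + 1 = 1 then (1 : L) else 0))) =>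
        N ((fun w => ((archPiEquivCM 2 L (Matrix.of fun i j : Fin 2 => if i.val + j.val + 1 = 2 then (1 : L) else 0) k.1 w : GL (Fin 2) ℂ) : Matrix (Fin 2) (Fin 2) ℂ)),
          (fun w => ((archPiEquivCM 1 L (Matrix.of fun i j : Fin 1 => if i.val + j.val + 1 = 1 then (1 : L) else 0) k.2 w : GL (Fin 1) ℂ) : Matrix (Fin 1) (Fin 1) ℂ) 0 0))) := by
  obtain ⟨β, hΦ⟩ := exists_contDiffBump_archSmooth₂_prod L a₀ b₀
  refine ⟨β.rIn, β.rIn_pos, fun N hN hsupp => ?_⟩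
  have h := ArchSmooth₂.placeMul L hΦ hN
  refine (congrArg (ArchSmooth₂ L) (funext fun k => ?_)).mp h
  -- either `N` vanishes at the blocks of `k`, or every bump factor equals `1`
  by_cases hk : N ((fun w => ((archPiEquivCM 2 L (Matrix.of fun i j : Fin 2 => if i.val + j.val + 1 = 2 then (1 : L) else 0) k.1 w : GL (Fin 2) ℂ) : Matrix (Fin 2) (Fin 2) ℂ)),
      (fun w => ((archPiEquivCM 1 L (Matrix.of fun i j : Fin 1 => if i.val + j.val + 1 = 1 then (1 : L) else 0) k.2 w : GL (Fin 1) ℂ) : Matrix (Fin 1) (Fin 1) ℂ) 0 0)) = 0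
  · rw [hk, zero_mul]
  obtain ⟨hA, hu⟩ := hsupp _ hk
  have hβ1 : ∀ t : ℝ, 0 ≤ t → t ≤ β.rIn → β t = 1 := fun t ht htr =>
    β.one_of_mem_closedBall (by rwa [Metric.mem_closedBall, dist_zero_right, Real.norm_of_nonneg ht])
  rw [Finset.prod_eq_one fun w _ => ?_, Finset.prod_eq_one fun w _ => ?_]
  · push_cast; ring
  · exact hβ1 _ (by positivity) (hu w)
  · rw [hβ1 _ (by positivity) (hA w), Complex.ofReal_one]

end BlockSupport

end Literature.NumberTheory.Rogawski1990

end
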